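import Mathlib
import HarnessLib
import Summits.HubbardSuperconductivity.HubbardSuperconductivity.Theorems.KLProgrammeKLRegimeSectorSlicePair
import Summits.HubbardSuperconductivity.HubbardSuperconductivity.Theorems.KLProgrammeKLRegimeSectorSliceCharSumMoment
import Summits.HubbardSuperconductivity.HubbardSuperconductivity.Theorems.KLProgrammeKLRegimeTorusL1MixedDifferencesMoment
import Summits.HubbardSuperconductivity.HubbardSuperconductivity.Theorems.KLProgrammeKLRegimeSliceSymbolTorusNbhdThird

/-!
# Route `KLProgramme` — engine support (route (L2), FIRST MOMENT, MIXED orders): the WEIGHTED `ℓ¹` norm of ONE sector-pair character sum of the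
# sectorised zero-seed counterterm slice covariance from MULTIPLIER DATA (orders ≤ 3) ALONE — the propagator side fully discharged (`C³` band)

Cell `gate-hubbard-kl`, seat hubbard-kl-k3c3-p2 (g8), for the ENGINE child stmt-HubbardSuperconductivity-20437 (`stub_engine_step_norms`: the WEIGHTED
lines `KernelNormsWt4 … K_n j` read by (e) via `hlev` and by (E4)ₙ; located risk «(b)-Wt@j≥1»).  The weighted/mixed-order twin of k3c2-p3's
`KLProgrammeKLRegimeSectorSlicePair.slicePair_charSum_l1_le`: the weighted row/column sums of `Sᵀ(F)·C^K_{(Λ,Λ′]}·S(F)` are `8·Σ_{ω′} T_w(ω,ω′)`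
(p3's `…SectorSliceRowsMoment` / `…EngineScaleWtSliceRows`), `T_w(ω,ω′)` the `(1 + s₀|z̃₁| + s₁|z̃₂|₁)`-weighted `ℓ¹` norm of the character sum with symbol
`G_{ωω′}(q) = (βL²)⁻²·M_{ωω′}(q)·Ψ̂(q)`.  p3 g10's mixed master lemma `sum_wt_norm_charSum_le_of_mixed_differences` (cure W1-MIXED) asks for THIRD
differences of `G` in time, along the axes, along `v⊥` (rates `s₀, s₁, s₂`) and along `v` at the ISOTROPIC rate `s₃′`, and SECOND differences along
`v` at the anisotropic rate `s₃`.  This file proves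

* §1 **`sliceCharSumWt_l1_le_of_mixed_data`** — the mixed master lemma with the support of `G` controlled by that of `M` (twin of p3's
  `sliceCharSumWt_l1_le_of_data`);
* §2 **`slicePairWt_charSum_l1_le`** — the per-pair WEIGHTED bound
  `T_w(ω,ω′) ≤ √(524288(1/s₀+1)[C_w′²(2√2/(s₂|v|)+2)(2√2/(s₃|v|)+2) + (1/s₁+1)²/(1+s₁R₀)]) · √(24·2M·L²·N_s) · (βL²)⁻²·4βL²/Λ`
  from: (frame) `‖De_K‖ ≤ K₁`, `‖D²e_K‖ ≤ K₂`, `‖D³e_K‖ ≤ K₃`; (cutoff) `|χ₂′| ≤ B₁`, `|χ₂″| ≤ B₂`, `|χ₂‴| ≤ B₃`; (scales) `0 < Λ ≤ Λ′ < π(2M−5)/β`;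
  (MULTIPLIER DATA) `‖M‖ ≤ 1`, `#{M ≠ 0} ≤ N_s`, pointwise `‖Δ_w^kM‖ ≤ a_k(w)`, `k ≤ 3`, in the five directions, the tangential datum
  `M q ≠ 0 ⇒ |De_K(c(q₂))·(2π/L)v| ≤ τ`; (RATES) `s₀, s₁, s₂, s₃, s₃′ > 0` with the SIX inequalities «Leibniz bound ≤ A₀(4/(s_wP_w))^k»,
  `A₀ = (βL²)⁻²·4βL²/Λ`, whose left sides are EXPLICIT in the data (the propagator factors are `KLProgrammeKLRegimeSliceSymbolTorusThird` /
  `…NbhdThird` (order 3, `C³` band) and k3c2-p3's order `≤ 2` ones).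

Everything is proved; no definitions, no named facts. [folklore]

References: G. Benfatto, A. Giuliani, V. Mastropietro, Ann. Henri Poincaré 7 (2006) 809–898, §2.8 (2.81), Lemma 2.2 (2.52)–(2.55) and footnote ¹;
M. Disertori, V. Rivasseau, Comm. Math. Phys. 215 (2000) 251–290, §IV.2 Lemma 4, App. A Lemma 12.
-/

noncomputable section

namespace Summit.HubbardSuperconductivity.HubbardSuperconductivity.Theorems.TorusFourierL2

set_option linter.dupNamespace false -- summit = problem name (single-conjunct summit), D-0017

open Finset Complex Literature.MathematicalPhysics.QuantumLattice Literature.Probability.LatticeModels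
open Summit.HubbardSuperconductivity.HubbardSuperconductivity.Theorems.DispersionFlow
open scoped Real

/-! ### §1 The per-pair WEIGHTED bound from mixed data -/

/-- **The weighted `ℓ¹` norm of one sector-pair character sum from MIXED data.**  Symbol `G(q) = c₀·(M(q)·Ψ(q))` on `(ℤ/P)¹ × (ℤ/L)²`;
`#{M ≠ 0} ≤ N_s`; `‖G‖ ≤ A₀`; third differences of `G` in time / along `e₁, e₂` / along `v⊥` / along `v` bounded by `A₀·(4/(s_wP_w))³`
(`s_w = s₀, s₁, s₂, s₃′`) and second differences along `v` by `A₀·(4/(s₃L))²`.  THEN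
`Σ_z (1 + s₀|z̃₁| + s₁|(z₂)̃₁| + s₁|(z₂)̃₂|)·‖Σ_q χ_{q₁}(z₁)χ_{q₂}(z₂) • G(q)‖
  ≤ √(524288(1/s₀+1)[C_w′²·(2√2/(s₂|v|)+2)(2√2/(s₃|v|)+2) + (1/s₁+1)²/(1+s₁R₀)])·√(24·P·L²·N_s)·A₀`
(p3's mixed master lemma with the support of `G` controlled by that of `M`). [cite: BenfattoGiulianiMastropietro2006, §2.8 (2.81)] -/
theorem sliceCharSumWt_l1_le_of_mixed_data {P L : ℕ} [NeZero P] [NeZero L] (c₀ : ℂ) (Mf Ψ : TorusSite 1 P × TorusSite 2 L → ℂ)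
    (v : Fin 2 → ℤ) (hv : v ≠ 0) {s₀ s₁ s₂ s₃ s₃' : ℝ} (hs₀ : 0 < s₀) (hs₁ : 0 < s₁) (hs₂ : 0 < s₂) (hs₃ : 0 < s₃) (hs₃' : 0 < s₃')
    {R₀ : ℕ} (hR₀ : 2 * (|v 0| + |v 1|) * (R₀ : ℤ) < L) {A₀ : ℝ} (hA₀ : 0 ≤ A₀) {Ns : ℕ}
    (hsupp : (univ.filter fun q => Mf q ≠ 0).card ≤ Ns)
    (hsup : ∀ q, ‖c₀ * (Mf q * Ψ q)‖ ≤ A₀)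
    (h₀ : ∀ q, ‖(fwdDiff ((fun _ : Fin 1 => (1 : ZMod P)), (0 : TorusSite 2 L)))^[3] (fun y => c₀ * (Mf y * Ψ y)) q‖ ≤
      A₀ * (4 / (s₀ * P)) ^ 3)
    (h₁ : ∀ q (i : Fin 2), ‖(fwdDiff ((0 : TorusSite 1 P), (Pi.single i (1 : ZMod L) : TorusSite 2 L)))^[3]
        (fun y => c₀ * (Mf y * Ψ y)) q‖ ≤ A₀ * (4 / (s₁ * L)) ^ 3)
    (h₂ : ∀ q, ‖(fwdDiff ((0 : TorusSite 1 P), (fun j => ((![-v 1, v 0] j : ℤ) : ZMod L))))^[3]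
        (fun y => c₀ * (Mf y * Ψ y)) q‖ ≤ A₀ * (4 / (s₂ * L)) ^ 3)
    (h₃ : ∀ q, ‖(fwdDiff ((0 : TorusSite 1 P), (fun j => ((v j : ℤ) : ZMod L))))^[2] (fun y => c₀ * (Mf y * Ψ y)) q‖ ≤
        A₀ * (4 / (s₃ * L)) ^ 2)
    (h₃' : ∀ q, ‖(fwdDiff ((0 : TorusSite 1 P), (fun j => ((v j : ℤ) : ZMod L))))^[3] (fun y => c₀ * (Mf y * Ψ y)) q‖ ≤
        A₀ * (4 / (s₃' * L)) ^ 3) :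
    ∑ z : TorusSite 1 P × TorusSite 2 L,
      (1 + s₀ * |(((z.1 0).valMinAbs : ℤ) : ℝ)| + s₁ * |(((z.2 0).valMinAbs : ℤ) : ℝ)| + s₁ * |(((z.2 1).valMinAbs : ℤ) : ℝ)|) *
        ‖∑ q : TorusSite 1 P × TorusSite 2 L, (torusChar q.1 z.1 * torusChar q.2 z.2) • (c₀ * (Mf q * Ψ q))‖ ≤
      Real.sqrt (524288 * (1 / s₀ + 1) *
          ((1 + 2 * Real.sqrt 2 * s₁ / (s₂ * Real.sqrt ((v 0 : ℝ) ^ 2 + (v 1 : ℝ) ^ 2)) +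
              2 * Real.sqrt 2 * s₁ / (s₃' * Real.sqrt ((v 0 : ℝ) ^ 2 + (v 1 : ℝ) ^ 2))) ^ 2 *
            ((2 * Real.sqrt 2 / (s₂ * Real.sqrt ((v 0 : ℝ) ^ 2 + (v 1 : ℝ) ^ 2)) + 2) *
              (2 * Real.sqrt 2 / (s₃ * Real.sqrt ((v 0 : ℝ) ^ 2 + (v 1 : ℝ) ^ 2)) + 2))
            + (1 / s₁ + 1) ^ 2 / (1 + s₁ * R₀))) *
        Real.sqrt (24 * P * (L : ℝ) ^ 2 * Ns) * A₀ := by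
  classical
  exact sum_wt_norm_charSum_le_of_mixed_differences (fun q => c₀ * (Mf q * Ψ q)) v hv hs₀ hs₁ hs₂ hs₃ hs₃' hR₀ hA₀
    ((card_support_smul_mul_le c₀ Mf Ψ).trans hsupp) hsup h₀ h₁ h₂ h₃ h₃'

/-! ### §2 The per-pair WEIGHTED bound with the propagator side discharged -/

section Pair

variable {L M : ℕ} [NeZero L] [NeZero M]

omit [NeZero L] [NeZero M] in
/-- The two-step window follows from the three-step one: `π(2M−5)/β ≤ π(2M−3)/β`. [folklore] -/
theorem window_three_le_two {β : ℝ} (hβ : 0 < β) : π * (2 * (M : ℝ) - 5) / β ≤ π * (2 * M - 3) / β :=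
  div_le_div_of_nonneg_right (mul_le_mul_of_nonneg_left (by linarith) Real.pi_pos.le) hβ.le

set_option maxHeartbeats 400000 in
/-- **The per-pair WEIGHTED `ℓ¹` bound from multiplier data** (orders `≤ 3`; `C³` band).  See the module docstring for the list of data; the six rate
inequalities `hr₀, hr₁, hr₂, hr₃, hr₃′` are the only arithmetic left to the instance.  Notation in the inequalities: `c = βL²`,
`w_r = toLp((2π/L)·r)`, `Kw_r = K₂‖w_r‖²`, `P₁ = (16B₁+16)c/Λ²`, `P₂ = (32B₂+144B₁+128)c/Λ³`, `P₃ = (64B₃+480B₂+1728B₁+1536)c/Λ⁴` (spelled out).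
(One disclosed heartbeat raise: the six explicit rate inequalities make the statement large.)
[cite: BenfattoGiulianiMastropietro2006, §2.8 (2.81), Lemma 2.2 (2.52)–(2.55)] -/
theorem slicePairWt_charSum_l1_le {β μ Λ Λ' : ℝ} {K : TrigPolyC4v} (hβ : 0 < β) (hΛ : 0 < Λ) (hΛΛ' : Λ ≤ Λ')
    (hM : Λ' < π * (2 * M - 5) / β)
    {K₁ K₂ K₃ : ℝ} (hK₁ : ∀ p, ‖fderiv ℝ (frameLevel μ K) p‖ ≤ K₁) (hK₂ : ∀ p, ‖iteratedFDeriv ℝ 2 (frameLevel μ K) p‖ ≤ K₂)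
    (hK₃ : ∀ p, ‖iteratedFDeriv ℝ 3 (frameLevel μ K) p‖ ≤ K₃)
    {B₁ B₂ B₃ : ℝ} (hB₁ : ∀ x, |deriv salmhoferCutoff x| ≤ B₁) (hB₂ : ∀ x, |deriv (deriv salmhoferCutoff) x| ≤ B₂)
    (hB₃ : ∀ x, |deriv (deriv (deriv salmhoferCutoff)) x| ≤ B₃)
    -- multiplier data
    (Mf : TorusSite 1 (2 * M) × TorusSite 2 L → ℂ) (hM0 : ∀ q, ‖Mf q‖ ≤ 1) {Ns : ℕ} (hsupp : (univ.filter fun q => Mf q ≠ 0).card ≤ Ns)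
    (v : Fin 2 → ℤ) (hv : v ≠ 0) {R₀ : ℕ} (hR₀ : 2 * (|v 0| + |v 1|) * (R₀ : ℤ) < L)
    {at₁ at₂ at₃ : ℝ} (hat₁ : 0 ≤ at₁) (hat₂ : 0 ≤ at₂) (hat₃ : 0 ≤ at₃)
    (hMt₁ : ∀ q, ‖fwdDiff ((fun _ : Fin 1 => (1 : ZMod (2 * M))), (0 : TorusSite 2 L)) Mf q‖ ≤ at₁)
    (hMt₂ : ∀ q, ‖(fwdDiff ((fun _ : Fin 1 => (1 : ZMod (2 * M))), (0 : TorusSite 2 L)))^[2] Mf q‖ ≤ at₂)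
    (hMt₃ : ∀ q, ‖(fwdDiff ((fun _ : Fin 1 => (1 : ZMod (2 * M))), (0 : TorusSite 2 L)))^[3] Mf q‖ ≤ at₃)
    (ae₁ ae₂ ae₃ : Fin 2 → ℝ) (hae₁ : ∀ i, 0 ≤ ae₁ i) (hae₂ : ∀ i, 0 ≤ ae₂ i) (hae₃ : ∀ i, 0 ≤ ae₃ i)
    (hMe₁ : ∀ q (i : Fin 2), ‖fwdDiff ((0 : TorusSite 1 (2 * M)), (Pi.single i (1 : ZMod L) : TorusSite 2 L)) Mf q‖ ≤ ae₁ i)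
    (hMe₂ : ∀ q (i : Fin 2), ‖(fwdDiff ((0 : TorusSite 1 (2 * M)), (Pi.single i (1 : ZMod L) : TorusSite 2 L)))^[2] Mf q‖ ≤ ae₂ i)
    (hMe₃ : ∀ q (i : Fin 2), ‖(fwdDiff ((0 : TorusSite 1 (2 * M)), (Pi.single i (1 : ZMod L) : TorusSite 2 L)))^[3] Mf q‖ ≤ ae₃ i)
    {an₁ an₂ an₃ : ℝ} (han₁ : 0 ≤ an₁) (han₂ : 0 ≤ an₂) (han₃ : 0 ≤ an₃)
    (hMn₁ : ∀ q, ‖fwdDiff ((0 : TorusSite 1 (2 * M)), (fun j => ((![-v 1, v 0] j : ℤ) : ZMod L))) Mf q‖ ≤ an₁)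
    (hMn₂ : ∀ q, ‖(fwdDiff ((0 : TorusSite 1 (2 * M)), (fun j => ((![-v 1, v 0] j : ℤ) : ZMod L))))^[2] Mf q‖ ≤ an₂)
    (hMn₃ : ∀ q, ‖(fwdDiff ((0 : TorusSite 1 (2 * M)), (fun j => ((![-v 1, v 0] j : ℤ) : ZMod L))))^[3] Mf q‖ ≤ an₃)
    {av₁ av₂ av₃ : ℝ} (hav₁ : 0 ≤ av₁) (hav₂ : 0 ≤ av₂) (hav₃ : 0 ≤ av₃)
    (hMv₁ : ∀ q, ‖fwdDiff ((0 : TorusSite 1 (2 * M)), (fun j => ((v j : ℤ) : ZMod L))) Mf q‖ ≤ av₁)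
    (hMv₂ : ∀ q, ‖(fwdDiff ((0 : TorusSite 1 (2 * M)), (fun j => ((v j : ℤ) : ZMod L))))^[2] Mf q‖ ≤ av₂)
    (hMv₃ : ∀ q, ‖(fwdDiff ((0 : TorusSite 1 (2 * M)), (fun j => ((v j : ℤ) : ZMod L))))^[3] Mf q‖ ≤ av₃)
    {τ : ℝ} (hτ0 : 0 ≤ τ)
    (hτ : ∀ q, Mf q ≠ 0 → |fderiv ℝ (frameLevel μ K) (WithLp.toLp 2 (torusCentredMomentum L q.2))
      (WithLp.toLp 2 (fun i => 2 * π / L * (v i : ℝ)))| ≤ τ)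
    -- rates and the six inequalities (`c = βL²`, `w_r = toLp ((2π/L)·r)`)
    {s₀ s₁ s₂ s₃ s₃' : ℝ} (hs₀ : 0 < s₀) (hs₁ : 0 < s₁) (hs₂ : 0 < s₂) (hs₃ : 0 < s₃) (hs₃' : 0 < s₃')
    (hr₀ : (1 / (β * (L : ℝ) ^ 2)) ^ 2 *
        (1 * ((2 * π / β) ^ 3 * ((64 * B₃ + 480 * B₂ + 1728 * B₁ + 1536) * (β * (L : ℝ) ^ 2) / Λ ^ 4)) +
          3 * (at₁ * ((2 * π / β) ^ 2 * ((32 * B₂ + 144 * B₁ + 128) * (β * (L : ℝ) ^ 2) / Λ ^ 3))) +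
          3 * (at₂ * ((2 * π / β) * ((16 * B₁ + 16) * (β * (L : ℝ) ^ 2) / Λ ^ 2))) +
          at₃ * (4 * (β * (L : ℝ) ^ 2) / Λ)) ≤
      (1 / (β * (L : ℝ) ^ 2)) ^ 2 * (4 * (β * (L : ℝ) ^ 2) / Λ) * (4 / (s₀ * (2 * M : ℕ))) ^ 3)
    (hr₁ : ∀ i : Fin 2, (1 / (β * (L : ℝ) ^ 2)) ^ 2 *
        (1 * ((64 * B₃ + 480 * B₂ + 1728 * B₁ + 1536) * (β * (L : ℝ) ^ 2) / Λ ^ 4 *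
              (K₁ * ‖(WithLp.toLp 2 (fun j => 2 * π / L * ((Pi.single i (1 : ℤ) : Fin 2 → ℤ) j : ℝ)) : EuclideanSpace ℝ (Fin 2))‖ +
                6 * (K₂ * ‖(WithLp.toLp 2 (fun j => 2 * π / L * ((Pi.single i (1 : ℤ) : Fin 2 → ℤ) j : ℝ)) :
                  EuclideanSpace ℝ (Fin 2))‖ ^ 2)) ^ 3 +
            3 * ((32 * B₂ + 144 * B₁ + 128) * (β * (L : ℝ) ^ 2) / Λ ^ 3 *
              (K₁ * ‖(WithLp.toLp 2 (fun j => 2 * π / L * ((Pi.single i (1 : ℤ) : Fin 2 → ℤ) j : ℝ)) : EuclideanSpace ℝ (Fin 2))‖ +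
                6 * (K₂ * ‖(WithLp.toLp 2 (fun j => 2 * π / L * ((Pi.single i (1 : ℤ) : Fin 2 → ℤ) j : ℝ)) :
                  EuclideanSpace ℝ (Fin 2))‖ ^ 2)) *
              (K₂ * ‖(WithLp.toLp 2 (fun j => 2 * π / L * ((Pi.single i (1 : ℤ) : Fin 2 → ℤ) j : ℝ)) : EuclideanSpace ℝ (Fin 2))‖ ^ 2)) +
            (16 * B₁ + 16) * (β * (L : ℝ) ^ 2) / Λ ^ 2 *
              (K₃ * ‖(WithLp.toLp 2 (fun j => 2 * π / L * ((Pi.single i (1 : ℤ) : Fin 2 → ℤ) j : ℝ)) : EuclideanSpace ℝ (Fin 2))‖ ^ 3)) +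
          3 * (ae₁ i * ((32 * B₂ + 144 * B₁ + 128) * (β * (L : ℝ) ^ 2) / Λ ^ 3 *
              (K₁ * ‖(WithLp.toLp 2 (fun j => 2 * π / L * ((Pi.single i (1 : ℤ) : Fin 2 → ℤ) j : ℝ)) : EuclideanSpace ℝ (Fin 2))‖ +
                5 * (K₂ * ‖(WithLp.toLp 2 (fun j => 2 * π / L * ((Pi.single i (1 : ℤ) : Fin 2 → ℤ) j : ℝ)) :
                  EuclideanSpace ℝ (Fin 2))‖ ^ 2)) ^ 2 +
            (16 * B₁ + 16) * (β * (L : ℝ) ^ 2) / Λ ^ 2 *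
              (K₂ * ‖(WithLp.toLp 2 (fun j => 2 * π / L * ((Pi.single i (1 : ℤ) : Fin 2 → ℤ) j : ℝ)) : EuclideanSpace ℝ (Fin 2))‖ ^ 2))) +
          3 * (ae₂ i * ((16 * B₁ + 16) * (β * (L : ℝ) ^ 2) / Λ ^ 2 *
              (K₁ * ‖(WithLp.toLp 2 (fun j => 2 * π / L * ((Pi.single i (1 : ℤ) : Fin 2 → ℤ) j : ℝ)) : EuclideanSpace ℝ (Fin 2))‖ +
                4 * (K₂ * ‖(WithLp.toLp 2 (fun j => 2 * π / L * ((Pi.single i (1 : ℤ) : Fin 2 → ℤ) j : ℝ)) :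
                  EuclideanSpace ℝ (Fin 2))‖ ^ 2)))) +
          ae₃ i * (4 * (β * (L : ℝ) ^ 2) / Λ)) ≤
      (1 / (β * (L : ℝ) ^ 2)) ^ 2 * (4 * (β * (L : ℝ) ^ 2) / Λ) * (4 / (s₁ * L)) ^ 3)
    (hr₂ : (1 / (β * (L : ℝ) ^ 2)) ^ 2 *
        (1 * ((64 * B₃ + 480 * B₂ + 1728 * B₁ + 1536) * (β * (L : ℝ) ^ 2) / Λ ^ 4 *
              (K₁ * ‖(WithLp.toLp 2 (fun j => 2 * π / L * ((![-v 1, v 0] : Fin 2 → ℤ) j : ℝ)) : EuclideanSpace ℝ (Fin 2))‖ +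
                6 * (K₂ * ‖(WithLp.toLp 2 (fun j => 2 * π / L * ((![-v 1, v 0] : Fin 2 → ℤ) j : ℝ)) : EuclideanSpace ℝ (Fin 2))‖ ^ 2)) ^ 3 +
            3 * ((32 * B₂ + 144 * B₁ + 128) * (β * (L : ℝ) ^ 2) / Λ ^ 3 *
              (K₁ * ‖(WithLp.toLp 2 (fun j => 2 * π / L * ((![-v 1, v 0] : Fin 2 → ℤ) j : ℝ)) : EuclideanSpace ℝ (Fin 2))‖ +
                6 * (K₂ * ‖(WithLp.toLp 2 (fun j => 2 * π / L * ((![-v 1, v 0] : Fin 2 → ℤ) j : ℝ)) : EuclideanSpace ℝ (Fin 2))‖ ^ 2)) *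
              (K₂ * ‖(WithLp.toLp 2 (fun j => 2 * π / L * ((![-v 1, v 0] : Fin 2 → ℤ) j : ℝ)) : EuclideanSpace ℝ (Fin 2))‖ ^ 2)) +
            (16 * B₁ + 16) * (β * (L : ℝ) ^ 2) / Λ ^ 2 *
              (K₃ * ‖(WithLp.toLp 2 (fun j => 2 * π / L * ((![-v 1, v 0] : Fin 2 → ℤ) j : ℝ)) : EuclideanSpace ℝ (Fin 2))‖ ^ 3)) +
          3 * (an₁ * ((32 * B₂ + 144 * B₁ + 128) * (β * (L : ℝ) ^ 2) / Λ ^ 3 *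
              (K₁ * ‖(WithLp.toLp 2 (fun j => 2 * π / L * ((![-v 1, v 0] : Fin 2 → ℤ) j : ℝ)) : EuclideanSpace ℝ (Fin 2))‖ +
                5 * (K₂ * ‖(WithLp.toLp 2 (fun j => 2 * π / L * ((![-v 1, v 0] : Fin 2 → ℤ) j : ℝ)) : EuclideanSpace ℝ (Fin 2))‖ ^ 2)) ^ 2 +
            (16 * B₁ + 16) * (β * (L : ℝ) ^ 2) / Λ ^ 2 *
              (K₂ * ‖(WithLp.toLp 2 (fun j => 2 * π / L * ((![-v 1, v 0] : Fin 2 → ℤ) j : ℝ)) : EuclideanSpace ℝ (Fin 2))‖ ^ 2))) +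
          3 * (an₂ * ((16 * B₁ + 16) * (β * (L : ℝ) ^ 2) / Λ ^ 2 *
              (K₁ * ‖(WithLp.toLp 2 (fun j => 2 * π / L * ((![-v 1, v 0] : Fin 2 → ℤ) j : ℝ)) : EuclideanSpace ℝ (Fin 2))‖ +
                4 * (K₂ * ‖(WithLp.toLp 2 (fun j => 2 * π / L * ((![-v 1, v 0] : Fin 2 → ℤ) j : ℝ)) : EuclideanSpace ℝ (Fin 2))‖ ^ 2)))) +
          an₃ * (4 * (β * (L : ℝ) ^ 2) / Λ)) ≤
      (1 / (β * (L : ℝ) ^ 2)) ^ 2 * (4 * (β * (L : ℝ) ^ 2) / Λ) * (4 / (s₂ * L)) ^ 3)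
    (hr₃ : (1 / (β * (L : ℝ) ^ 2)) ^ 2 *
        (1 * ((32 * B₂ + 144 * B₁ + 128) * (β * (L : ℝ) ^ 2) / Λ ^ 3 *
              (τ + 4 * (K₂ * ‖(WithLp.toLp 2 (fun j => 2 * π / L * (v j : ℝ)) : EuclideanSpace ℝ (Fin 2))‖ ^ 2)) ^ 2 +
            (16 * B₁ + 16) * (β * (L : ℝ) ^ 2) / Λ ^ 2 *
              (K₂ * ‖(WithLp.toLp 2 (fun j => 2 * π / L * (v j : ℝ)) : EuclideanSpace ℝ (Fin 2))‖ ^ 2)) +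
          2 * (av₁ * ((16 * B₁ + 16) * (β * (L : ℝ) ^ 2) / Λ ^ 2 *
              (τ + 3 * (K₂ * ‖(WithLp.toLp 2 (fun j => 2 * π / L * (v j : ℝ)) : EuclideanSpace ℝ (Fin 2))‖ ^ 2)))) +
          av₂ * (4 * (β * (L : ℝ) ^ 2) / Λ)) ≤
      (1 / (β * (L : ℝ) ^ 2)) ^ 2 * (4 * (β * (L : ℝ) ^ 2) / Λ) * (4 / (s₃ * L)) ^ 2)
    (hr₃' : (1 / (β * (L : ℝ) ^ 2)) ^ 2 *
        (1 * ((64 * B₃ + 480 * B₂ + 1728 * B₁ + 1536) * (β * (L : ℝ) ^ 2) / Λ ^ 4 *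
              (τ + 6 * (K₂ * ‖(WithLp.toLp 2 (fun j => 2 * π / L * (v j : ℝ)) : EuclideanSpace ℝ (Fin 2))‖ ^ 2)) ^ 3 +
            3 * ((32 * B₂ + 144 * B₁ + 128) * (β * (L : ℝ) ^ 2) / Λ ^ 3 *
              (τ + 6 * (K₂ * ‖(WithLp.toLp 2 (fun j => 2 * π / L * (v j : ℝ)) : EuclideanSpace ℝ (Fin 2))‖ ^ 2)) *
              (K₂ * ‖(WithLp.toLp 2 (fun j => 2 * π / L * (v j : ℝ)) : EuclideanSpace ℝ (Fin 2))‖ ^ 2)) +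
            (16 * B₁ + 16) * (β * (L : ℝ) ^ 2) / Λ ^ 2 *
              (K₃ * ‖(WithLp.toLp 2 (fun j => 2 * π / L * (v j : ℝ)) : EuclideanSpace ℝ (Fin 2))‖ ^ 3)) +
          3 * (av₁ * ((32 * B₂ + 144 * B₁ + 128) * (β * (L : ℝ) ^ 2) / Λ ^ 3 *
              (τ + 5 * (K₂ * ‖(WithLp.toLp 2 (fun j => 2 * π / L * (v j : ℝ)) : EuclideanSpace ℝ (Fin 2))‖ ^ 2)) ^ 2 +
            (16 * B₁ + 16) * (β * (L : ℝ) ^ 2) / Λ ^ 2 *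
              (K₂ * ‖(WithLp.toLp 2 (fun j => 2 * π / L * (v j : ℝ)) : EuclideanSpace ℝ (Fin 2))‖ ^ 2))) +
          3 * (av₂ * ((16 * B₁ + 16) * (β * (L : ℝ) ^ 2) / Λ ^ 2 *
              (τ + 4 * (K₂ * ‖(WithLp.toLp 2 (fun j => 2 * π / L * (v j : ℝ)) : EuclideanSpace ℝ (Fin 2))‖ ^ 2)))) +
          av₃ * (4 * (β * (L : ℝ) ^ 2) / Λ)) ≤
      (1 / (β * (L : ℝ) ^ 2)) ^ 2 * (4 * (β * (L : ℝ) ^ 2) / Λ) * (4 / (s₃' * L)) ^ 3) :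
    ∑ z : TorusSite 1 (2 * M) × TorusSite 2 L,
        (1 + s₀ * |(((z.1 0).valMinAbs : ℤ) : ℝ)| + s₁ * |(((z.2 0).valMinAbs : ℤ) : ℝ)| + s₁ * |(((z.2 1).valMinAbs : ℤ) : ℝ)|) *
        ‖∑ q : TorusSite 1 (2 * M) × TorusSite 2 L, (torusChar q.1 z.1 * torusChar q.2 z.2) •
          ((((1 / (β * (L : ℝ) ^ 2) : ℝ) : ℂ) ^ 2 *
            (Mf q * sliceSymbolFnXi (β * (L : ℝ) ^ 2) 0 Λ Λ' (matsubaraFreq β M ⟨(q.1 0).val, ZMod.val_lt (q.1 0)⟩)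
              (nambuXiCT L μ K q.2))))‖ ≤
      Real.sqrt (524288 * (1 / s₀ + 1) *
          ((1 + 2 * Real.sqrt 2 * s₁ / (s₂ * Real.sqrt ((v 0 : ℝ) ^ 2 + (v 1 : ℝ) ^ 2)) +
              2 * Real.sqrt 2 * s₁ / (s₃' * Real.sqrt ((v 0 : ℝ) ^ 2 + (v 1 : ℝ) ^ 2))) ^ 2 *
            ((2 * Real.sqrt 2 / (s₂ * Real.sqrt ((v 0 : ℝ) ^ 2 + (v 1 : ℝ) ^ 2)) + 2) *
              (2 * Real.sqrt 2 / (s₃ * Real.sqrt ((v 0 : ℝ) ^ 2 + (v 1 : ℝ) ^ 2)) + 2))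
            + (1 / s₁ + 1) ^ 2 / (1 + s₁ * R₀))) *
        Real.sqrt (24 * (2 * M : ℕ) * (L : ℝ) ^ 2 * Ns) * ((1 / (β * (L : ℝ) ^ 2)) ^ 2 * (4 * (β * (L : ℝ) ^ 2) / Λ)) := by
  classical
  -- abbreviations
  have hM3 : Λ' < π * (2 * M - 3) / β := hM.trans_le (window_three_le_two (M := M) hβ)
  set c : ℝ := β * (L : ℝ) ^ 2 with hc_def
  have hc : 0 ≤ c := by positivity
  set c₀ : ℂ := (((1 / (β * (L : ℝ) ^ 2) : ℝ) : ℂ)) ^ 2 with hc₀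
  have hc₀n : ‖c₀‖ = (1 / (β * (L : ℝ) ^ 2)) ^ 2 := by
    rw [hc₀, norm_pow, Complex.norm_real, Real.norm_eq_abs, abs_of_nonneg (by positivity)]
  set Ψ : TorusSite 1 (2 * M) × TorusSite 2 L → ℂ := fun q =>
    sliceSymbolFnXi (β * (L : ℝ) ^ 2) 0 Λ Λ' (matsubaraFreq β M ⟨(q.1 0).val, ZMod.val_lt (q.1 0)⟩) (nambuXiCT L μ K q.2) with hΨ
  have hB10 : 0 ≤ B₁ := (abs_nonneg _).trans (hB₁ 0)
  have hB20 : 0 ≤ B₂ := (abs_nonneg _).trans (hB₂ 0)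
  have hB30 : 0 ≤ B₃ := (abs_nonneg _).trans (hB₃ 0)
  have hK10 : 0 ≤ K₁ := le_trans (norm_nonneg _) (hK₁ 0)
  have hK20 : 0 ≤ K₂ := le_trans (norm_nonneg _) (hK₂ 0)
  have hK30 : 0 ≤ K₃ := le_trans (norm_nonneg _) (hK₃ 0)
  -- propagator data: sup (everywhere)
  have hΨ0 : ∀ q, ‖Ψ q‖ ≤ 4 * c / Λ := fun q => norm_sliceSymbolTorus_le (K := K) (β := β) (μ := μ) hΛ hΛΛ' hc q
  have hb0 : 0 ≤ 4 * c / Λ := by positivity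
  -- the sup of `G`
  have hsup : ∀ q, ‖c₀ * (Mf q * Ψ q)‖ ≤ ‖c₀‖ * (4 * c / Λ) := by
    intro q
    have h := norm_smul_mul_le_of_support c₀ Mf Ψ zero_le_one hb0 hM0 (fun x _ => hΨ0 x) q
    simpa only [one_mul] using h
  have hA₀ : 0 ≤ ‖c₀‖ * (4 * c / Λ) := by positivity
  -- time direction, order three
  have htime : ∀ q, ‖(fwdDiff ((fun _ : Fin 1 => (1 : ZMod (2 * M))), (0 : TorusSite 2 L)))^[3] (fun y => c₀ * (Mf y * Ψ y)) q‖ ≤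
      ‖c₀‖ * (1 * ((2 * π / β) ^ 3 * ((64 * B₃ + 480 * B₂ + 1728 * B₁ + 1536) * c / Λ ^ 4)) +
        3 * (at₁ * ((2 * π / β) ^ 2 * ((32 * B₂ + 144 * B₁ + 128) * c / Λ ^ 3))) +
        3 * (at₂ * ((2 * π / β) * ((16 * B₁ + 16) * c / Λ ^ 2))) + at₃ * (4 * c / Λ)) := by
    intro q
    exact norm_fwdDiff_iter_three_smul_mul_le_of_support _ c₀ Mf Ψ zero_le_one hat₁ hat₂ hat₃ hb0 (by positivity) (by positivity)
      (by positivity) hM0 hMt₁ hMt₂ hMt₃ (fun x _ => hΨ0 x)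
      (fun x _ => norm_fwdDiff_time_sliceSymbolTorus_le (K := K) (μ := μ) hβ hΛ hΛΛ' hM3 hc hB₁ x)
      (fun x _ => norm_fwdDiff_two_time_sliceSymbolTorus_le (K := K) (μ := μ) hβ hΛ hΛΛ' hM3 hc hB₁ hB₂ x)
      (fun x _ => norm_fwdDiff_three_time_sliceSymbolTorus_le (K := K) (μ := μ) hβ hΛ hΛΛ' hM hc hB₁ hB₂ hB₃ x) q
  -- generic space direction at order three, with tangential datum `τ'` on the support
  have hspace3 : ∀ (r : Fin 2 → ℤ) (τ' a₁ a₂ a₃ : ℝ), 0 ≤ τ' → 0 ≤ a₁ → 0 ≤ a₂ → 0 ≤ a₃ →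
      (∀ q, ‖fwdDiff ((0 : TorusSite 1 (2 * M)), (fun j => ((r j : ℤ) : ZMod L))) Mf q‖ ≤ a₁) →
      (∀ q, ‖(fwdDiff ((0 : TorusSite 1 (2 * M)), (fun j => ((r j : ℤ) : ZMod L))))^[2] Mf q‖ ≤ a₂) →
      (∀ q, ‖(fwdDiff ((0 : TorusSite 1 (2 * M)), (fun j => ((r j : ℤ) : ZMod L))))^[3] Mf q‖ ≤ a₃) →
      (∀ q, Mf q ≠ 0 → |fderiv ℝ (frameLevel μ K) (WithLp.toLp 2 (torusCentredMomentum L q.2))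
        (WithLp.toLp 2 (fun i => 2 * π / L * (r i : ℝ)))| ≤ τ') →
      ∀ q, ‖(fwdDiff ((0 : TorusSite 1 (2 * M)), (fun j => ((r j : ℤ) : ZMod L))))^[3] (fun y => c₀ * (Mf y * Ψ y)) q‖ ≤
        ‖c₀‖ * (1 * ((64 * B₃ + 480 * B₂ + 1728 * B₁ + 1536) * c / Λ ^ 4 *
              (τ' + 6 * (K₂ * ‖(WithLp.toLp 2 (fun j => 2 * π / L * (r j : ℝ)) : EuclideanSpace ℝ (Fin 2))‖ ^ 2)) ^ 3 +
            3 * ((32 * B₂ + 144 * B₁ + 128) * c / Λ ^ 3 *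
              (τ' + 6 * (K₂ * ‖(WithLp.toLp 2 (fun j => 2 * π / L * (r j : ℝ)) : EuclideanSpace ℝ (Fin 2))‖ ^ 2)) *
              (K₂ * ‖(WithLp.toLp 2 (fun j => 2 * π / L * (r j : ℝ)) : EuclideanSpace ℝ (Fin 2))‖ ^ 2)) +
            (16 * B₁ + 16) * c / Λ ^ 2 * (K₃ * ‖(WithLp.toLp 2 (fun j => 2 * π / L * (r j : ℝ)) : EuclideanSpace ℝ (Fin 2))‖ ^ 3)) +
          3 * (a₁ * ((32 * B₂ + 144 * B₁ + 128) * c / Λ ^ 3 *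
              (τ' + 5 * (K₂ * ‖(WithLp.toLp 2 (fun j => 2 * π / L * (r j : ℝ)) : EuclideanSpace ℝ (Fin 2))‖ ^ 2)) ^ 2 +
            (16 * B₁ + 16) * c / Λ ^ 2 * (K₂ * ‖(WithLp.toLp 2 (fun j => 2 * π / L * (r j : ℝ)) : EuclideanSpace ℝ (Fin 2))‖ ^ 2))) +
          3 * (a₂ * ((16 * B₁ + 16) * c / Λ ^ 2 *
              (τ' + 4 * (K₂ * ‖(WithLp.toLp 2 (fun j => 2 * π / L * (r j : ℝ)) : EuclideanSpace ℝ (Fin 2))‖ ^ 2)))) +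
          a₃ * (4 * c / Λ)) := by
    intro r τ' a₁ a₂ a₃ hτ' ha₁ ha₂ ha₃ hM1 hM2 hM3' hτr q
    exact norm_fwdDiff_iter_three_smul_mul_le_of_support _ c₀ Mf Ψ zero_le_one ha₁ ha₂ ha₃ hb0 (by positivity) (by positivity)
      (by positivity) hM0 hM1 hM2 hM3' (fun x _ => hΨ0 x)
      (fun x hx => norm_fwdDiff_space_sliceSymbolTorus_le_of_near_support_three (β := β) hK₂ hΛ hΛΛ' hc hB₁ Mf r hτr x hx)
      (fun x hx => norm_fwdDiff_two_space_sliceSymbolTorus_le_of_near_support_three (β := β) hK₂ hΛ hΛΛ' hc hB₁ hB₂ Mf r hτr x hx)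
      (fun x hx => norm_fwdDiff_three_space_sliceSymbolTorus_le_of_near_support (β := β) hK₂ hK₃ hΛ hΛΛ' hc hB₁ hB₂ hB₃ Mf r hτr x hx) q
  -- the space direction `v` at order two (the anisotropic rate), with tangential datum `τ`
  have hspace2 : ∀ q, ‖(fwdDiff ((0 : TorusSite 1 (2 * M)), (fun j => ((v j : ℤ) : ZMod L))))^[2] (fun y => c₀ * (Mf y * Ψ y)) q‖ ≤
        ‖c₀‖ * (1 * ((32 * B₂ + 144 * B₁ + 128) * c / Λ ^ 3 *
              (τ + 4 * (K₂ * ‖(WithLp.toLp 2 (fun j => 2 * π / L * (v j : ℝ)) : EuclideanSpace ℝ (Fin 2))‖ ^ 2)) ^ 2 +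
            (16 * B₁ + 16) * c / Λ ^ 2 * (K₂ * ‖(WithLp.toLp 2 (fun j => 2 * π / L * (v j : ℝ)) : EuclideanSpace ℝ (Fin 2))‖ ^ 2)) +
          2 * (av₁ * ((16 * B₁ + 16) * c / Λ ^ 2 *
              (τ + 3 * (K₂ * ‖(WithLp.toLp 2 (fun j => 2 * π / L * (v j : ℝ)) : EuclideanSpace ℝ (Fin 2))‖ ^ 2)))) +
          av₂ * (4 * c / Λ)) := by
    intro q
    exact norm_fwdDiff_iter_two_smul_mul_le_of_support _ c₀ Mf Ψ zero_le_one hav₁ hav₂ hb0 (by positivity) (by positivity)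
      hM0 hMv₁ hMv₂ (fun x _ => hΨ0 x)
      (fun x hx => norm_fwdDiff_space_sliceSymbolTorus_le_of_near_support (β := β) hK₂ hΛ hΛΛ' hc hB₁ Mf v hτ x hx)
      (fun x hx => norm_fwdDiff_two_space_sliceSymbolTorus_le_of_near_support (β := β) hK₂ hΛ hΛΛ' hc hB₁ hB₂ Mf v hτ x hx) q
  -- the isotropic tangential datum for `e₁, e₂, v⊥`
  have htriv : ∀ (r : Fin 2 → ℤ) (q : TorusSite 1 (2 * M) × TorusSite 2 L), Mf q ≠ 0 →
      |fderiv ℝ (frameLevel μ K) (WithLp.toLp 2 (torusCentredMomentum L q.2)) (WithLp.toLp 2 (fun i => 2 * π / L * (r i : ℝ)))| ≤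
        K₁ * ‖(WithLp.toLp 2 (fun j => 2 * π / L * (r j : ℝ)) : EuclideanSpace ℝ (Fin 2))‖ :=
    fun r q _ => abs_fderiv_apply_le_of_norm_le hK₁ _ _
  -- `Pi.single i 1` as the reduction of the integer vector `Pi.single i 1`
  have hsingle : ∀ i : Fin 2, (Pi.single i (1 : ZMod L) : TorusSite 2 L) = fun j => (((Pi.single i (1 : ℤ) : Fin 2 → ℤ) j : ℤ) : ZMod L) := by
    intro i; funext j
    by_cases h : j = i
    · subst h; simp
    · simp [h]
  -- assemble via the mixed master lemma
  have hA : ‖c₀‖ * (4 * c / Λ) = (1 / c) ^ 2 * (4 * c / Λ) := by rw [hc₀n]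
  rw [← hA]
  refine sliceCharSumWt_l1_le_of_mixed_data c₀ Mf Ψ v hv hs₀ hs₁ hs₂ hs₃ hs₃' hR₀ hA₀ hsupp hsup ?_ ?_ ?_ ?_ ?_
  · intro q
    refine (htime q).trans ?_
    rw [hc₀n]; exact hr₀
  · intro q i
    rw [hsingle i]
    refine (hspace3 (Pi.single i (1 : ℤ)) _ (ae₁ i) (ae₂ i) (ae₃ i) (by positivity) (hae₁ i) (hae₂ i) (hae₃ i)
      (fun q => by rw [← hsingle i]; exact hMe₁ q i) (fun q => by rw [← hsingle i]; exact hMe₂ q i)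
      (fun q => by rw [← hsingle i]; exact hMe₃ q i) (htriv _) q).trans ?_
    rw [hc₀n]; exact hr₁ i
  · intro q
    refine (hspace3 (![-v 1, v 0]) _ an₁ an₂ an₃ (by positivity) han₁ han₂ han₃ hMn₁ hMn₂ hMn₃ (htriv _) q).trans ?_
    rw [hc₀n]; exact hr₂
  · intro q
    refine (hspace2 q).trans ?_
    rw [hc₀n]; exact hr₃
  · intro q
    refine (hspace3 v τ av₁ av₂ av₃ hτ0 hav₁ hav₂ hav₃ hMv₁ hMv₂ hMv₃ hτ q).trans ?_
    rw [hc₀n]; exact hr₃'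

end Pair

end Summit.HubbardSuperconductivity.HubbardSuperconductivity.Theorems.TorusFourierL2

end
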